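import Literature.NumberTheory.Transcendental.NesterenkoEliminationFacts
import Literature.Barriers.Schanuel.NesterenkoModularScopeMeasureClaim
import Mathlib.Analysis.SpecialFunctions.Pow.Real
import HarnessLib

/-!
# Philippon's criterion over Nesterenko's toolkit, VI: choosing a small prime component (Prop. 4.7) — proofs only

`Literature/NumberTheory/Transcendental/PhilipponCriterionComponent.lean` — proofs only (no new
definitions, nothing asserted). In Philippon's proof of his criterion (Publ. Math. IHÉS 64 (1986),
§3, pp. 44–45) each intersection step ends by passing from the (specialised) eliminant form
`ρ(f) = ∏ f_h^{e_h}` to ONE of its prime factors: "on déduit de cette majoration qu'il existe un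
idéal premier minimal … associé à `ρ(𝔓_{N,r}[…])`, de forme U-éliminante `f_h`, tel que
`‖𝔓_{N,r−1}‖ ≤ exp(−(h(f_h) + τ(N) d°f_h) · Φ)`" — the smallness is distributed over the prime
components proportionally to their size `h + τ·deg`, and one component inherits the relative
smallness. On Nesterenko's side the additivity is LNM 1752 Ch. 3 Prop. 4.7
(`NesterenkoPhilippon2001_ch3_prop_4_7`: `∑ k_j deg 𝔭_j = deg I`, `∑ k_j h(𝔭_j) ≤ h(I) + m² deg I`,
`∏ |𝔭_j(ω̄)|^{k_j} ≤ |I(ω̄)| e^{m³ deg I}`), and this file proves the resulting **weighted pigeonhole**: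

* `exists_component_le_exp` — for a homogeneous unmixed `I` of rank `r`, weights `a, b ≥ 0`
  (`a = δ(N)`, `b = τ(N)` in the application), `T > 0` with `a (h(I) + m² deg I) + b deg I ≤ T` and
  `|I(ω̄)| ≤ e^{−U}` with `m³ deg I ≤ U`, some prime component `𝔮 = √Q` of a reduced primary
  decomposition has `|𝔮(ω̄)| ≤ exp(−((U − m³ deg I)/T) · (a h(𝔮) + b deg 𝔮))`, and
  `deg 𝔮 ≤ deg I`, `h(𝔮) ≤ h(I) + m² deg I`;
* `ideg_radical_le`, `iheight_radical_le` — the latter two bounds for EVERY component.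

## References

* [Philippon1986Criteres] P. Philippon, Publ. Math. IHÉS 64 (1986), §3, pp. 44–45.
* [NesterenkoPhilippon2001] LNM 1752 (2001), Ch. 3 Prop. 4.7 (p. 39).
-/

noncomputable section

open MvPolynomial Real
open Literature.NumberTheory.Transcendental.Nesterenko

attribute [local instance] MvPolynomial.gradedAlgebra

namespace Literature.NumberTheory.Transcendental

namespace PhilipponMain

variable {m r : ℕ}

/-! ### Bounds for every component from Proposition 4.7 1), 2) -/

/-- From Prop. 4.7 1): every prime component has `deg 𝔮 ≤ deg I` (`k_Q ≥ 1` and all terms are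
non-negative). [cite: NesterenkoPhilippon2001, Ch. 3 Prop. 4.7 1) (p. 39)] -/
theorem ideg_radical_le {I : Ideal (Rx m)} {t : Finset (Ideal (Rx m))}
    (hsum1 : ∑ Q ∈ t, primaryExponent Q * ideg Q.radical r = ideg I r)
    (hk : ∀ Q ∈ t, 1 ≤ primaryExponent Q) {Q : Ideal (Rx m)} (hQ : Q ∈ t) :
    ideg Q.radical r ≤ ideg I r := by
  calc ideg Q.radical r ≤ primaryExponent Q * ideg Q.radical r :=
        Nat.le_mul_of_pos_left _ (hk Q hQ)
    _ ≤ ∑ Q' ∈ t, primaryExponent Q' * ideg Q'.radical r :=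
        Finset.single_le_sum (f := fun Q' => primaryExponent Q' * ideg Q'.radical r)
          (fun _ _ => Nat.zero_le _) hQ
    _ = ideg I r := hsum1

/-- From Prop. 4.7 2): every prime component has `h(𝔮) ≤ h(I) + m² deg I`.
[cite: NesterenkoPhilippon2001, Ch. 3 Prop. 4.7 2) (p. 39)] -/
theorem iheight_radical_le {I : Ideal (Rx m)} {t : Finset (Ideal (Rx m))}
    (hsum2 : ∑ Q ∈ t, (primaryExponent Q : ℝ) * iheight Q.radical r ≤
      iheight I r + (m : ℝ) ^ 2 * ideg I r)
    (hk : ∀ Q ∈ t, 1 ≤ primaryExponent Q) {Q : Ideal (Rx m)} (hQ : Q ∈ t) :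
    iheight Q.radical r ≤ iheight I r + (m : ℝ) ^ 2 * ideg I r := by
  have h0 : ∀ Q' ∈ t, 0 ≤ (primaryExponent Q' : ℝ) * iheight Q'.radical r :=
    fun Q' _ => mul_nonneg (Nat.cast_nonneg _) (height_nonneg _)
  have hk1 : (1 : ℝ) ≤ primaryExponent Q := by exact_mod_cast hk Q hQ
  calc iheight Q.radical r ≤ (primaryExponent Q : ℝ) * iheight Q.radical r :=
        le_mul_of_one_le_left (height_nonneg _) hk1
    _ ≤ ∑ Q' ∈ t, (primaryExponent Q' : ℝ) * iheight Q'.radical r :=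
        Finset.single_le_sum (f := fun Q' => (primaryExponent Q' : ℝ) * iheight Q'.radical r) h0 hQ
    _ ≤ iheight I r + (m : ℝ) ^ 2 * ideg I r := hsum2

/-! ### The weighted pigeonhole over Proposition 4.7 3) -/

/-- The abstract pigeonhole: if reals `x_Q` with integer exponents `k_Q ≥ 1` and
sizes `s_Q` satisfy `∏ x_Q^{k_Q} ≤ e^{−U'}`, `∑ k_Q s_Q ≤ T`, with `0 ≤ U'`, `0 < T`,
over a non-empty index set, then `x_Q ≤ exp(−(U'/T) s_Q)` for some `Q`. [folklore] -/
theorem exists_le_exp_of_prod_le {ι : Type*} {t : Finset ι} (ht : t.Nonempty)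
    {x s : ι → ℝ} {kQ : ι → ℕ} {U' T : ℝ} (hU' : 0 ≤ U') (hT : 0 < T)
    (hk : ∀ Q ∈ t, 1 ≤ kQ Q)
    (hsum : ∑ Q ∈ t, (kQ Q : ℝ) * s Q ≤ T) (hprod : ∏ Q ∈ t, x Q ^ kQ Q ≤ exp (-U')) :
    ∃ Q ∈ t, x Q ≤ exp (-(U' / T) * s Q) := by
  by_contra hcon
  push Not at hcon
  -- every factor `exp(−(U'/T) s_Q)^{k_Q}` is strictly below `x_Q^{k_Q}`
  have hf0 : ∀ Q ∈ t, 0 < exp (-(U' / T) * s Q) ^ kQ Q := fun Q _ => pow_pos (exp_pos _) _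
  have hle : ∀ Q ∈ t, exp (-(U' / T) * s Q) ^ kQ Q ≤ x Q ^ kQ Q := fun Q hQ =>
    pow_le_pow_left₀ (exp_pos _).le (hcon Q hQ).le _
  obtain ⟨Q₀, hQ₀⟩ := ht
  have hk0 : kQ Q₀ ≠ 0 := by have := hk Q₀ hQ₀; omega
  have hlt : ∏ Q ∈ t, exp (-(U' / T) * s Q) ^ kQ Q < ∏ Q ∈ t, x Q ^ kQ Q :=
    Finset.prod_lt_prod hf0 hle ⟨Q₀, hQ₀, pow_lt_pow_left₀ (hcon Q₀ hQ₀) (exp_pos _).le hk0⟩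
  -- while the left-hand side is at least `exp(−U')`
  have hL : exp (-U') ≤ ∏ Q ∈ t, exp (-(U' / T) * s Q) ^ kQ Q := by
    have e1 : ∏ Q ∈ t, exp (-(U' / T) * s Q) ^ kQ Q =
        exp (∑ Q ∈ t, (kQ Q : ℝ) * (-(U' / T) * s Q)) := by
      rw [exp_sum]
      refine Finset.prod_congr rfl fun Q _ => ?_
      rw [exp_nat_mul]
    have e2 : ∑ Q ∈ t, (kQ Q : ℝ) * (-(U' / T) * s Q) = -(U' / T) * ∑ Q ∈ t, (kQ Q : ℝ) * s Q := by
      rw [Finset.mul_sum]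
      refine Finset.sum_congr rfl fun Q _ => ?_
      ring
    rw [e1, exp_le_exp, e2]
    have hUT : 0 ≤ U' / T := div_nonneg hU' hT.le
    have h1 := mul_le_mul_of_nonneg_left hsum hUT
    have e3 : U' / T * T = U' := div_mul_cancel₀ U' hT.ne'
    nlinarith
  have h := (lt_of_le_of_lt hL hlt).trans_le hprod
  exact lt_irrefl _ h

/-- **A small prime component.** Let `I ⊂ ℚ[x₀, …, x_m]` be homogeneous unmixed of rank `r`
(`1 ≤ r ≤ m`), `ω̄ ≠ 0`, `t` a reduced primary decomposition of `I`, weights `a ≥ 0`, `b`, `T > 0` with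
`a (h(I) + m² deg I) + b deg I ≤ T`, and `|I(ω̄)| ≤ e^{−U}` with `m³ deg I ≤ U`. Then some `Q ∈ t` has
`|√Q (ω̄)| ≤ exp(−((U − m³ deg I)/T) · (a h(√Q) + b deg √Q))` (Prop. 4.7 3) and the pigeonhole).
[cite: Philippon1986Criteres, §3 pp. 44–45] [cite: NesterenkoPhilippon2001, Ch. 3 Prop. 4.7 (p. 39)] -/
theorem exists_component_le_exp (h47 : NesterenkoPhilippon2001_ch3_prop_4_7) (hr1 : 1 ≤ r)
    (hrm : r ≤ m) {I : Ideal (Rx m)} (hIhom : I.IsHomogeneous (homogeneousSubmodule (Fin (m + 1)) ℚ))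
    (hIunm : IsUnmixedOfRank I r) {t : Finset (Ideal (Rx m))}
    (ht : Submodule.IsMinimalPrimaryDecomposition I t) {ω : Fin (m + 1) → ℂ} (hω : ω ≠ 0)
    {a b T U : ℝ} (ha : 0 ≤ a) (hT : 0 < T)
    (hTle : a * (iheight I r + (m : ℝ) ^ 2 * ideg I r) + b * ideg I r ≤ T)
    (hU : (m : ℝ) ^ 3 * ideg I r ≤ U) (hI : iabs I r ω ≤ exp (-U)) :
    ∃ Q ∈ t, iabs Q.radical r ω ≤
      exp (-((U - (m : ℝ) ^ 3 * ideg I r) / T) * (a * iheight Q.radical r + b * ideg Q.radical r)) := by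
  classical
  obtain ⟨hsum1, hsum2, hprod3⟩ := h47 m r I hr1 hrm hIhom hIunm t ht ω hω
  have hQfacts := fun (Q : Ideal (Rx m)) (hQ : Q ∈ t) =>
    Literature.Barriers.Schanuel.radical_component_facts hIhom hIunm ht hQ
  -- `t ≠ ∅`
  have htne : t.Nonempty := by
    rw [Finset.nonempty_iff_ne_empty]
    rintro rfl
    apply hIunm.1
    have := ht.inf_eq
    simpa using this.symm
  -- the sizes and the weighted sum
  set s : Ideal (Rx m) → ℝ := fun Q => a * iheight Q.radical r + b * ideg Q.radical r with hs
  have hsum : ∑ Q ∈ t, (primaryExponent Q : ℝ) * s Q ≤ T := by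
    have h1 : ∑ Q ∈ t, (primaryExponent Q : ℝ) * s Q =
        a * ∑ Q ∈ t, (primaryExponent Q : ℝ) * iheight Q.radical r +
          b * ∑ Q ∈ t, (primaryExponent Q : ℝ) * (ideg Q.radical r : ℝ) := by
      simp only [hs, Finset.mul_sum, ← Finset.sum_add_distrib]
      refine Finset.sum_congr rfl fun Q _ => ?_
      ring
    have h2 : ∑ Q ∈ t, (primaryExponent Q : ℝ) * (ideg Q.radical r : ℝ) = ideg I r := by
      have := congrArg (fun n : ℕ => (n : ℝ)) hsum1
      push_cast at this
      exact this
    rw [h1, h2]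
    calc a * ∑ Q ∈ t, (primaryExponent Q : ℝ) * iheight Q.radical r + b * (ideg I r : ℝ)
        ≤ a * (iheight I r + (m : ℝ) ^ 2 * ideg I r) + b * ideg I r := by
          have := mul_le_mul_of_nonneg_left hsum2 ha
          linarith
      _ ≤ T := hTle
  -- the product
  have hprod : ∏ Q ∈ t, iabs Q.radical r ω ^ primaryExponent Q ≤
      exp (-(U - (m : ℝ) ^ 3 * ideg I r)) := by
    refine hprod3.trans ?_
    calc iabs I r ω * exp ((m : ℝ) ^ 3 * ideg I r)
        ≤ exp (-U) * exp ((m : ℝ) ^ 3 * ideg I r) :=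
          mul_le_mul_of_nonneg_right hI (exp_pos _).le
      _ = exp (-(U - (m : ℝ) ^ 3 * ideg I r)) := by rw [← exp_add]; ring_nf
  exact exists_le_exp_of_prod_le htne (by linarith) hT (fun Q hQ => (hQfacts Q hQ).2.2.2.2) hsum hprod

end PhilipponMain

end Literature.NumberTheory.Transcendental

end
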